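import Literature.NumberTheory.Sieve.ZhangBoundedGaps
import Literature.NumberTheory.Sieve.MaynardSieve
import Literature.NumberTheory.Sieve.MaynardSieveLemma62
import Literature.NumberTheory.Sieve.MaynardSieveLemma52
import Literature.NumberTheory.Sieve.MaynardSieveLemma63Sum
import Literature.NumberTheory.Sieve.MaynardSieveYm
import Literature.NumberTheory.Sieve.GoldstonGrahamPintzYildirimProofs
import Literature.NumberTheory.Sieve.GoldstonGrahamPintzYildirimLemma3
import Literature.NumberTheory.LFunctions.SiegelWalfisz
import Literature.NumberTheory.LFunctions.SchoenfeldSieve.Chunk00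
import Literature.NumberTheory.LFunctions.SchoenfeldSieve.Chunk01
import Literature.NumberTheory.LFunctions.SchoenfeldSieve.Chunk02
import Literature.NumberTheory.LFunctions.SchoenfeldSieve.Chunk03
import Literature.NumberTheory.LFunctions.SchoenfeldSieve.Chunk04
import Literature.NumberTheory.LFunctions.SchoenfeldSieve.Chunk05
import Literature.NumberTheory.LFunctions.SchoenfeldSieve.Chunk06
import Literature.NumberTheory.LFunctions.SchoenfeldSieve.Chunk07
import Literature.NumberTheory.LFunctions.SchoenfeldSieve.Chunk08
import Literature.NumberTheory.LFunctions.SchoenfeldSieve.Chunk09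
import Literature.NumberTheory.LFunctions.SchoenfeldSieve.Chunk10
import Literature.NumberTheory.LFunctions.SchoenfeldSieve.Chunk11
import Literature.NumberTheory.LFunctions.SchoenfeldSieve.Chunk12
import Literature.NumberTheory.LFunctions.SchoenfeldSieve.Chunk13
import HarnessLib

/-!
# Zhang's bounded gaps theorem: the discharge layer (theorems only)

Companion to `Literature.NumberTheory.Sieve.ZhangBoundedGaps`, which vendors Zhang's Theorem 1
(Y. Zhang, *Bounded gaps between primes*, Ann. of Math. 179 (2014), 1121–1174: main clause
`Literature.NumberTheory.Sieve.weakDHL_two_zhang` = `DHL[k₀, 2]` for `k₀ ≥ 3.5·10⁶`; consequence clause = parity.S13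
`Literature.NumberTheory.Sieve.frequently_nth_prime_succ_lt_add_zhang`, `liminf (p_{n+1} − p_n) < 7·10⁷`) and reduces both to
Bombieri–Vinogradov / Siegel–Walfisz and Maynard's Proposition 4.2 in its general (square-integrable `F`)
form `Literature.NumberTheory.Sieve.frequently_card_primes_ge_of_maynardFunctional`.  This file (PROVED theorems only; it is where the
discharge `frequently_nth_prime_succ_lt_add_zhang_holds` will be appended) carries the same reductions in
the forms the tree's decomposition of Prop. 4.2 actually delivers (`Literature.NumberTheory.Sieve.MaynardSieve`):

* the `C¹`-test-function case `Literature.NumberTheory.Sieve.frequently_card_primes_ge_of_maynardFunctional_smooth` (`F = G · 1_{R_k}`,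
  `G ∈ C¹` — the class Maynard's Prop. 4.1 is stated for and to which §7 applies it), which suffices because
  the certified test function of `MaynardK105` (`M₁₀₅ > 4`, Prop. 4.3(2)) is a polynomial cut off to `R₁₀₅`:
  `weakDHL_105_two_of_smooth` (`DHL[105, 2]` from `BombieriVinogradovStatement` and the `C¹` fact, Maynard §4,
  proof of Thm 1.3, arXiv p. 8), `frequently_nth_prime_succ_le_add_maynard_of_weakDHL` (`DHL[105, 2]` and
  Engelsma's tuple `maynardTuple ⊆ [0, 600]` give Maynard's `≤ 600`),
  `frequently_nth_prime_succ_lt_add_zhang_of_siegelWalfisz_of_smooth`, `weakDHL_two_zhang_of_siegelWalfisz_of_smooth`;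
* the two halves of Prop. 4.1, `Literature.NumberTheory.Sieve.maynard_S1_asymptotic` (Lemma 6.2) and `Literature.NumberTheory.Sieve.maynard_S2_asymptotic`
  (Lemma 6.3), from which `MaynardSieve` proves the `C¹` case
  (`frequently_card_primes_ge_of_maynardFunctional_smooth_of_asymptotics`):
  `frequently_nth_prime_succ_lt_add_zhang_of_bombieri_vinogradov_of_sieveAsymptotics`,
  `frequently_nth_prime_succ_lt_add_zhang_of_siegelWalfisz_of_sieveAsymptotics`,
  `weakDHL_two_zhang_of_siegelWalfisz_of_sieveAsymptotics`.

So `frequently_nth_prime_succ_lt_add_zhang_holds` = `…_of_siegelWalfisz_of_sieveAsymptotics` applied to the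
discharges of parity.S28 `siegel_walfisz`, `maynard_S1_asymptotic`, `maynard_S2_asymptotic` — all of which have
landed; the last section of this file performs that assembly (**both clauses of Zhang's Theorem 1 are PROVED**:
`frequently_nth_prime_succ_lt_add_zhang_holds`, `weakDHL_two_zhang_holds`), from

* `Literature.NumberTheory.LFunctions.siegel_walfisz_holds` (`Literature.NumberTheory.LFunctions.SiegelWalfisz`: parity.S28, Montgomery–Vaughan
  Cor. 11.19, from the zero-free region MV Thm. 11.3, Siegel's theorem MV Cor. 11.15 and Landau's method), whence
  Bombieri–Vinogradov by `bombieri_vinogradov_of_siegelWalfisz` (`VaughanMeanValue`: Vaughan 1980 + the large sieve);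
* `Literature.NumberTheory.Sieve.maynard_S1_asymptotic_holds` (`MaynardSieveLemma62`: Maynard Lemma 6.2 from Lemmas 5.1, 6.2);
* the `S₂` half `Literature.NumberTheory.Sieve.maynard_S2_asymptotic` (Maynard Lemma 6.3) assembled exactly as in the tree's Maynard leaf
  (`ParityWave0MaynardHolds`): `maynard_S2_asymptotic_of` (`MaynardSieveS2`) applied to Lemma 5.2
  (`maynard_lemma52_holds`, `MaynardSieveLemma52`), the evaluation (6.10) of `y^{(m)}` (`maynard_lemma63_ym_of_GGPY`,
  `MaynardSieveYm`, fed with Goldston–Graham–Pintz–Yıldırım 2009, Lemmas 3–4: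
  `GGPY.moebiusSqGSumWeighted_asymptotic_of GGPY.moebiusSqGSum_asymptotic_holds`,
  `GoldstonGrahamPintzYildirimProofs` / `GoldstonGrahamPintzYildirimLemma3`) and (6.11)–(6.14)
  (`maynard_lemma63_sum_holds`, `MaynardSieveLemma63Sum`).

The last section discharges the remaining named fact of `ZhangBoundedGaps`, Zhang's **numerical input**
`Literature.NumberTheory.Sieve.primeCounting_zhang` (`π(3.5·10⁶) + 3.5·10⁶ < π(7·10⁷)`, the inequality
`π(7·10⁷) − π(3.5·10⁶) > 3.5·10⁶` behind "Consequently `liminf (p_{n+1} − p_n) < 7·10⁷`", for which Zhang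
appeals to Dusart's explicit bounds): not from Dusart but from the tree's CERTIFIED PRIME COUNTS — the blocks
`Literature.NumberTheory.LFunctions.SchoenfeldSieve.checkSeg_00 … checkSeg_13` of the computation of Schoenfeld's
(6.18) below `10⁸` (`SchoenfeldSieve.lean` + `SchoenfeldSieve/Chunk00–13.lean`: trial division over the
kernel-verified table of the primes `≤ 10007`; each block one `native_decide`, declared `computational`), whose
invariant `SegOK a c` records `c = π(a − 1)` at every boundary `a = 5·10⁶·j`: `π(5·10⁶ − 1) = 348 513` and
`π(7·10⁷ − 1) = 4 118 064`, whence `π(7·10⁷) = 4 118 064` (`7·10⁷` is even), `π(3.5·10⁶) ≤ 348 513` by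
monotonicity, and `348 513 + 3 500 000 = 3 848 513 < 4 118 064` (`primeCounting_zhang_holds`; these three
declarations inherit `Lean.ofReduceBool` from the blocks).  With it, Zhang's own one-sentence deduction
`frequently_nth_prime_succ_lt_add_zhang_of_weakDHL` runs on two proved inputs
(`frequently_nth_prime_succ_lt_add_zhang_of_primeCounts`).

NOTE ON THE PROOF ROUTE. This discharge is *not* Zhang's printed argument (Zhang's Theorem 2 — a
Bombieri–Vinogradov type estimate of level `1/2 + 1/584` restricted to smooth moduli — combined with the
Goldston–Pintz–Yıldırım sieve for `k₀ = 3.5·10⁶`); it is the Maynard–Tao route (multidimensional sieve weights at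
level `θ < 1/2`, `k = 105`, `M₁₀₅ > 4`), which proves the stronger `liminf (p_{n+1} − p_n) ≤ 600 < 7·10⁷` and, by
monotonicity of `DHL[k, 2]` in `k`, Zhang's main clause for every `k₀ ≥ 105 ⊇ {k₀ ≥ 3.5·10⁶}`. The vendored
statements are Zhang's, unchanged.

## References

* Y. Zhang, *Bounded gaps between primes*, Ann. of Math. (2) 179 (2014), 1121–1174, Theorem 1. [cite: ZhangAnnals2014]
* J. Maynard, *Small gaps between primes*, Ann. of Math. (2) 181 (2015), 383–413, arXiv:1311.4600:
  Prop. 4.1 (= Lemmas 6.2, 6.3), Prop. 4.2, Prop. 4.3, and the proof of Theorem 1.3 (arXiv numbering;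
  `liminf ≤ 600`) in §4, p. 8. [cite: MaynardAnnals2015]
* R. C. Vaughan, *An elementary method in prime number theory*, Acta Arith. 37 (1980), 111–115, Theorem 3
  (Bombieri–Vinogradov from the mean value theorem and Siegel–Walfisz). [cite: Vaughan1980]
* M. Ram Murty, *The twin prime problem and generalisations (après Yitang Zhang)*, Asia Pac. Math. Newsl. 3
  (2013) no. 4, 7–14, p. 9 (Zhang's deduction: `k₀` primes in `[3.5·10⁶, 7·10⁷]`,
  `π(7·10⁷) − π(3.5·10⁶) > 3.5·10⁶`). [cite: RamMurty2013Zhang]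
* L. Schoenfeld, *Sharper bounds for the Chebyshev functions θ(x) and ψ(x). II*, Math. Comp. 30 (1976),
  337–360, proof of Cor. 1 (the range below `10⁸` by tables of `π(x)`; here the tree's certified blocks
  `SchoenfeldSieve/Chunk00–13`). [cite: Schoenfeld1976]
-/

open Filter Finset

namespace Literature.NumberTheory.Sieve

/-! ### Zhang's Theorem 1 via the `C¹` form of Maynard's Proposition 4.2 (the form its printed proof delivers) -/

/-- **`DHL[105, 2]` from Bombieri–Vinogradov and the `C¹`-test-function form of Maynard's
Proposition 4.2** (`Literature.NumberTheory.Sieve.frequently_card_primes_ge_of_maynardFunctional_smooth`, `MaynardSieve`: the case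
`F = G · 1_{R_k}`, `G ∈ C¹`, which is what Maynard's Prop. 4.1 (§§5–6) delivers and all that the proof of
Theorem 1.3 consumes).  The certified test function of `MaynardK105` is of this form:
`maynardF 105 A b c = 1_{R₁₀₅} · P` with `P = maynardPoly 105 A b c` a polynomial
(`MaynardK105.contDiff_maynardPoly`), and `MaynardK105.isMaynardAdmissible_and_four_lt_cert105` gives
admissibility and `M > 4`; then `θ` with `2/M < θ < 1/2` as in the proof of Theorem 1.3 (arXiv p. 8).
[cite: MaynardAnnals2015, §4, proof of Theorem 1.3 of arXiv:1311.4600 (p. 8); §7 (the polynomial F)] -/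
theorem weakDHL_105_two_of_smooth (hBV : BombieriVinogradovStatement)
    (h42 : frequently_card_primes_ge_of_maynardFunctional_smooth) : WeakDicksonHardyLittlewood 105 2 := by
  obtain ⟨hF, h4⟩ := MaynardK105.isMaynardAdmissible_and_four_lt_cert105
  set G : (Fin (104 + 1) → ℝ) → ℝ := MaynardK105.maynardPoly (104 + 1)
    (fun i => (MaynardK105.certA i : ℝ)) MaynardK105.certB MaynardK105.certC with hGdef
  have hG : ContDiff ℝ 1 G := MaynardK105.contDiff_maynardPoly _ _ _ _
  have hFG : MaynardK105.maynardF (104 + 1) (fun i => (MaynardK105.certA i : ℝ)) MaynardK105.certB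
      MaynardK105.certC = (maynardSimplex (104 + 1)).indicator G := rfl
  rw [hFG] at hF h4
  set M := maynardFunctional (104 + 1) ((maynardSimplex (104 + 1)).indicator G) with hMdef
  have h4' : 4 < M := by exact_mod_cast h4
  have hM0 : 0 < M := by linarith
  obtain ⟨θ, hθ1, hθ2⟩ := exists_between (show 2 / M < 1 / 2 by
    rw [div_lt_iff₀ hM0]; linarith)
  have hθ0 : 0 < θ := lt_trans (div_pos two_pos hM0) hθ1
  have hMθ : 2 * ((1:ℕ) : ℝ) / θ < M := by
    rw [div_lt_iff₀ hM0] at hθ1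
    rw [Nat.cast_one, mul_one, div_lt_iff₀ hθ0]
    linarith [mul_comm θ M]
  intro H hH hk
  exact h42 θ hθ0 (hBV θ hθ2) 1 (104 + 1) G hG hF hMθ H hH hk

/-- Maynard's `liminf (p_{n+1} − p_n) ≤ 600` (parity.S13, `frequently_nth_prime_succ_le_add_maynard`) from
`DHL[105, 2]` and Engelsma's admissible `105`-tuple `Literature.maynardTuple ⊆ [0, 600]` of
`ParityWave0MaynardProofs` (Maynard, arXiv:1311.4600, §4, p. 8: "`liminf (p_{n+1} − p_n) ≤ max (hᵢ − hⱼ)`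
for any admissible set … `h₁₀₅ − h₁ = 600`"), via the accepted
`WeakDicksonHardyLittlewood.frequently_nth_prime_add_le`. [cite: MaynardAnnals2015, Theorem 1.3, deduction in §4 (p. 8)] -/
theorem frequently_nth_prime_succ_le_add_maynard_of_weakDHL (h : WeakDicksonHardyLittlewood 105 2) :
    frequently_nth_prime_succ_le_add_maynard :=
  h.frequently_nth_prime_add_le (m := 1) isAdmissibleTuple_maynardTuple card_maynardTuple (d := 600)
    fun a ha b hb => by
      have h1 := mem_maynardTuple_bounds a ha
      have h2 := mem_maynardTuple_bounds b hb
      push_cast at h1 h2 ⊢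
      omega

/-- **Zhang's statement from Siegel–Walfisz and the `C¹` form of Maynard's Proposition 4.2** — the
frontier of the discharge in the form the tree's decomposition of Prop. 4.2 (`MaynardSieve`:
`…_smooth_of_asymptotics` from the Prop. 4.1 asymptotics) will deliver: parity.S28 `siegel_walfisz` gives
Bombieri–Vinogradov (`bombieri_vinogradov_of_siegelWalfisz`, `bombieriVinogradovStatement_of_bombieri_vinogradov`),
hence `DHL[105, 2]` (`weakDHL_105_two_of_smooth`), Maynard's `≤ 600`
(`frequently_nth_prime_succ_le_add_maynard_of_weakDHL`) and Zhang's `< 7·10⁷`.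
[cite: MaynardAnnals2015, Theorem 1.3 and its proof in §4][cite: Vaughan1980, Theorem 3] -/
theorem frequently_nth_prime_succ_lt_add_zhang_of_siegelWalfisz_of_smooth (hSW : siegel_walfisz)
    (h42 : frequently_card_primes_ge_of_maynardFunctional_smooth) : frequently_nth_prime_succ_lt_add_zhang :=
  frequently_nth_prime_succ_lt_add_zhang_of_maynard (frequently_nth_prime_succ_le_add_maynard_of_weakDHL
    (weakDHL_105_two_of_smooth
      (bombieriVinogradovStatement_of_bombieri_vinogradov (bombieri_vinogradov_of_siegelWalfisz hSW)) h42))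

/-- Zhang's main clause `weakDHL_two_zhang` from Siegel–Walfisz and the `C¹` form of Maynard's
Proposition 4.2 (monotonicity of `DHL[k, 2]` in `k` from `DHL[105, 2]`). [cite: ZhangAnnals2014, Theorem 1 (main clause)][cite: MaynardAnnals2015, §4 (k = 105 under Bombieri–Vinogradov)] -/
theorem weakDHL_two_zhang_of_siegelWalfisz_of_smooth (hSW : siegel_walfisz)
    (h42 : frequently_card_primes_ge_of_maynardFunctional_smooth) : weakDHL_two_zhang :=
  fun _ hk => (weakDHL_105_two_of_smooth
    (bombieriVinogradovStatement_of_bombieri_vinogradov (bombieri_vinogradov_of_siegelWalfisz hSW)) h42).of_le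
      (le_trans (by norm_num) hk)

/-! ### Zhang's Theorem 1 from the two halves of Maynard's Proposition 4.1 (the leaves the tree is discharging) -/

/-- **Zhang's statement from parity.S27 and Maynard's Proposition 4.1** (`maynard_S1_asymptotic` =
Lemma 6.2, `maynard_S2_asymptotic` = Lemma 6.3, the two named facts of `MaynardSieve` to which the tree has
reduced Prop. 4.2, `frequently_card_primes_ge_of_maynardFunctional_smooth_of_asymptotics`): Bombieri–Vinogradov
in level form (`bombieriVinogradovStatement_of_bombieri_vinogradov`), `DHL[105, 2]` (`weakDHL_105_two_of_smooth`),
Maynard's `≤ 600` (`frequently_nth_prime_succ_le_add_maynard_of_weakDHL`) and `600 < 7·10⁷`.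
[cite: MaynardAnnals2015, Theorem 1.3 and its proof in §4; Prop. 4.1] -/
theorem frequently_nth_prime_succ_lt_add_zhang_of_bombieri_vinogradov_of_sieveAsymptotics
    (hBV : bombieri_vinogradov) (hS1 : maynard_S1_asymptotic) (hS2 : maynard_S2_asymptotic) :
    frequently_nth_prime_succ_lt_add_zhang :=
  frequently_nth_prime_succ_lt_add_zhang_of_maynard (frequently_nth_prime_succ_le_add_maynard_of_weakDHL
    (weakDHL_105_two_of_smooth (bombieriVinogradovStatement_of_bombieri_vinogradov hBV)
      (frequently_card_primes_ge_of_maynardFunctional_smooth_of_asymptotics hS1 hS2)))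

/-- **Zhang's statement from the three leaves currently open in the tree**: parity.S28 `siegel_walfisz`
(whence Bombieri–Vinogradov, `bombieri_vinogradov_of_siegelWalfisz`, Vaughan's mean value theorem being
proved in `VaughanMeanValue`) and Maynard's Prop. 4.1 (`maynard_S1_asymptotic`, `maynard_S2_asymptotic`).
The discharge `frequently_nth_prime_succ_lt_add_zhang_holds` is this theorem applied to the three `_holds`,
once they land. [cite: MaynardAnnals2015, Theorem 1.3 and its proof in §4; Prop. 4.1][cite: Vaughan1980, Theorem 3] -/
theorem frequently_nth_prime_succ_lt_add_zhang_of_siegelWalfisz_of_sieveAsymptotics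
    (hSW : siegel_walfisz) (hS1 : maynard_S1_asymptotic) (hS2 : maynard_S2_asymptotic) :
    frequently_nth_prime_succ_lt_add_zhang :=
  frequently_nth_prime_succ_lt_add_zhang_of_bombieri_vinogradov_of_sieveAsymptotics
    (bombieri_vinogradov_of_siegelWalfisz hSW) hS1 hS2

/-- Zhang's main clause `weakDHL_two_zhang` (`DHL[k₀, 2]`, `k₀ ≥ 3.5·10⁶`) from the same three leaves
(`weakDHL_two_zhang_of_siegelWalfisz_of_smooth` and
`frequently_card_primes_ge_of_maynardFunctional_smooth_of_asymptotics`). [cite: ZhangAnnals2014, Theorem 1 (main clause)][cite: MaynardAnnals2015, Prop. 4.1, Prop. 4.2 and §4] -/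
theorem weakDHL_two_zhang_of_siegelWalfisz_of_sieveAsymptotics
    (hSW : siegel_walfisz) (hS1 : maynard_S1_asymptotic) (hS2 : maynard_S2_asymptotic) :
    weakDHL_two_zhang :=
  weakDHL_two_zhang_of_siegelWalfisz_of_smooth hSW
    (frequently_card_primes_ge_of_maynardFunctional_smooth_of_asymptotics hS1 hS2)

/-! ### The discharges: both clauses of Zhang's Theorem 1, PROVED

Every leaf of the reduction above has landed in the tree, so Zhang's Theorem 1 — the consequence clause
parity.S13 `frequently_nth_prime_succ_lt_add_zhang` (`liminf (p_{n+1} − p_n) < 7·10⁷`, Zhang (1.5)) and the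
main clause `weakDHL_two_zhang` (`DHL[k₀, 2]` for all `k₀ ≥ 3.5·10⁶`) — is now a theorem of the tree (all
axioms standard; no named fact remains on the path).  The `S₂` term below is literally the one used for
Maynard's Theorem 1.3 in `ParityWave0MaynardHolds` (it is also recorded as `Literature.NumberTheory.Sieve.maynard_S2_asymptotic_holds` in
`MaynardTaoTheoremProofs`, not imported here to keep this file on already-built modules). -/

/-- **Zhang's Theorem 1 (consequence clause (1.5)), PROVED**: `liminf_n (p_{n+1} − p_n) < 7·10⁷`, i.e. the
Wave-0 named fact parity.S13 `Literature.NumberTheory.Sieve.frequently_nth_prime_succ_lt_add_zhang`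
(`∃ᶠ n, p_{n+1} < p_n + 7·10⁷`) DISCHARGED — via the Maynard–Tao route rather than Zhang's own Theorem 2:
Siegel–Walfisz (`siegel_walfisz_holds`, MV Cor. 11.19) ⇒ Bombieri–Vinogradov (Vaughan) ⇒ with Maynard's
Prop. 4.1 (`maynard_S1_asymptotic_holds`; `maynard_S2_asymptotic_of` Lemma 5.2, (6.10) from GGPY Lemmas 3–4,
(6.11)–(6.14)), `M₁₀₅ > 4` and Engelsma's 105-tuple: gaps `≤ 600 < 7·10⁷` infinitely often
(`frequently_nth_prime_succ_lt_add_zhang_of_siegelWalfisz_of_sieveAsymptotics`).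
[cite: ZhangAnnals2014, Theorem 1][cite: MaynardAnnals2015, Theorem 1.3 and its proof in §4; Prop. 4.1] -/
theorem frequently_nth_prime_succ_lt_add_zhang_holds : frequently_nth_prime_succ_lt_add_zhang :=
  frequently_nth_prime_succ_lt_add_zhang_of_siegelWalfisz_of_sieveAsymptotics LFunctions.siegel_walfisz_holds
    maynard_S1_asymptotic_holds
    (maynard_S2_asymptotic_of maynard_lemma52_holds
      (maynard_lemma63_ym_of_GGPY
        (GGPY.moebiusSqGSumWeighted_asymptotic_of GGPY.moebiusSqGSum_asymptotic_holds))
      maynard_lemma63_sum_holds)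

/-- **Zhang's Theorem 1 (main clause), PROVED**: `DHL[k₀, 2]` for every `k₀ ≥ 3.5·10⁶` — every admissible
`k₀`-tuple `𝓗` has infinitely many translates `n + 𝓗` containing at least two primes — i.e. the named fact
`Literature.NumberTheory.Sieve.weakDHL_two_zhang` of `ZhangBoundedGaps` DISCHARGED, from the same three leaves
(`weakDHL_two_zhang_of_siegelWalfisz_of_sieveAsymptotics`: `DHL[105, 2]` under Bombieri–Vinogradov, Maynard §4,
and monotonicity in `k`).  Again the route is Maynard's, not Zhang's Theorem 2.
[cite: ZhangAnnals2014, Theorem 1 (main clause)][cite: MaynardAnnals2015, Prop. 4.1, Prop. 4.2 and §4] -/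
theorem weakDHL_two_zhang_holds : weakDHL_two_zhang :=
  weakDHL_two_zhang_of_siegelWalfisz_of_sieveAsymptotics LFunctions.siegel_walfisz_holds
    maynard_S1_asymptotic_holds
    (maynard_S2_asymptotic_of maynard_lemma52_holds
      (maynard_lemma63_ym_of_GGPY
        (GGPY.moebiusSqGSumWeighted_asymptotic_of GGPY.moebiusSqGSum_asymptotic_holds))
      maynard_lemma63_sum_holds)

/-! ### Zhang's numerical input `π(7·10⁷) − π(3.5·10⁶) > 3.5·10⁶`, PROVED from certified prime counts

The blocks `checkSeg_00, …, checkSeg_13` of `Literature.NumberTheory.LFunctions.SchoenfeldSieve` (each a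
`native_decide`, `computational`) are chained by `segOK_step` from `segOK_start : SegOK 2659 384`
(`π(2658) = 384`, a kernel `decide`); the first component of `SegOK a c` is `c = π(a − 1)`.  Everything in
this section therefore carries `Lean.ofReduceBool` (and nothing else beyond the standard axioms). -/

open LFunctions.SchoenfeldSieve in
/-- **`π(5·10⁶ − 1) = 348 513`, certified**: block 00 of the tree's computation of Schoenfeld's (6.18)
(`checkSeg_00 : checkSeg 2659 5000000 384 348513 = true`, trial division over the kernel-verified table of
the primes `≤ 10007`) chained onto `segOK_start` (`π(2658) = 384`).  (`SegOK a c` also records (6.18) on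
`[2659, a)`, not used here.) [folklore] -/
theorem segOK_fiveMillion : LFunctions.SchoenfeldSieve.SegOK 5000000 348513 :=
  segOK_step checkSeg_00 (by norm_num) (by norm_num) (by norm_num) segOK_start

open LFunctions.SchoenfeldSieve in
/-- **`π(7·10⁷ − 1) = 4 118 064`, certified**: blocks 01–13 of the same computation
(`checkSeg_01, …, checkSeg_13`, boundaries `5·10⁶·j`, `j = 1, …, 14`) chained onto `segOK_fiveMillion`.
[folklore] -/
theorem segOK_seventyMillion : LFunctions.SchoenfeldSieve.SegOK 70000000 4118064 :=
  segOK_step checkSeg_13 (by norm_num) (by norm_num) (by norm_num) <|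
    segOK_step checkSeg_12 (by norm_num) (by norm_num) (by norm_num) <|
    segOK_step checkSeg_11 (by norm_num) (by norm_num) (by norm_num) <|
    segOK_step checkSeg_10 (by norm_num) (by norm_num) (by norm_num) <|
    segOK_step checkSeg_09 (by norm_num) (by norm_num) (by norm_num) <|
    segOK_step checkSeg_08 (by norm_num) (by norm_num) (by norm_num) <|
    segOK_step checkSeg_07 (by norm_num) (by norm_num) (by norm_num) <|
    segOK_step checkSeg_06 (by norm_num) (by norm_num) (by norm_num) <|
    segOK_step checkSeg_05 (by norm_num) (by norm_num) (by norm_num) <|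
    segOK_step checkSeg_04 (by norm_num) (by norm_num) (by norm_num) <|
    segOK_step checkSeg_03 (by norm_num) (by norm_num) (by norm_num) <|
    segOK_step checkSeg_02 (by norm_num) (by norm_num) (by norm_num) <|
    segOK_step checkSeg_01 (by norm_num) (by norm_num) (by norm_num) segOK_fiveMillion

/-- **`π(4 999 999) = 348 513`** (certified; first component of `segOK_fiveMillion`). [folklore] -/
theorem primeCounting_pred_fiveMillion : Nat.primeCounting 4999999 = 348513 :=
  segOK_fiveMillion.1.symm

/-- **`π(69 999 999) = 4 118 064`** (certified; first component of `segOK_seventyMillion`). [folklore] -/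
theorem primeCounting_pred_seventyMillion : Nat.primeCounting 69999999 = 4118064 :=
  segOK_seventyMillion.1.symm

/-- `π(m) = π(n)` when `m = n + 1` is not prime (`Nat.count_succ`; stated with a separate `m` so that it
applies to large numerals without unfolding). [folklore] -/
theorem primeCounting_eq_of_not_prime {n m : ℕ} (hm : m = n + 1) (h : ¬ m.Prime) :
    Nat.primeCounting m = Nat.primeCounting n := by
  subst hm
  simp only [Nat.primeCounting, Nat.primeCounting', Nat.count_succ, if_neg h, Nat.add_zero]

/-- **`π(7·10⁷) = 4 118 064`** (certified): `7·10⁷` is even, so `π(7·10⁷) = π(7·10⁷ − 1)`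
(`primeCounting_eq_of_not_prime`), and `primeCounting_pred_seventyMillion`.  This is the true value quoted
in the docstring of `Literature.NumberTheory.Sieve.primeCounting_zhang`. [folklore] -/
theorem primeCounting_seventyMillion : Nat.primeCounting (7 * 10 ^ 7) = 4118064 := by
  have hnp : ¬ Nat.Prime 70000000 := by norm_num
  rw [show (7 * 10 ^ 7 : ℕ) = 70000000 by norm_num,
    primeCounting_eq_of_not_prime (n := 69999999) (by norm_num) hnp, primeCounting_pred_seventyMillion]

/-- **`π(3.5·10⁶) ≤ 348 513`** (`π` is monotone and `π(4 999 999) = 348 513`; the true value is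
`π(3.5·10⁶) = 250 150`, not needed). [folklore] -/
theorem primeCounting_threePointFiveMillion_le : Nat.primeCounting 3500000 ≤ 348513 :=
  primeCounting_pred_fiveMillion ▸ Nat.monotone_primeCounting (by norm_num)

/-- **Zhang's numerical input, PROVED**: `π(3.5·10⁶) + 3.5·10⁶ < π(7·10⁷)`, i.e. the named fact
`Literature.NumberTheory.Sieve.primeCounting_zhang` of `ZhangBoundedGaps` DISCHARGED (Y. Zhang, Ann. of Math. 179
(2014), Theorem 1, the deduction of "Consequently `liminf (p_{n+1} − p_n) < 7 × 10⁷`": a set of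
`k₀ = 3.5·10⁶` primes in `[3.5·10⁶, 7·10⁷]` exists "since `π(7 × 10⁷) − π(3.5 × 10⁶) > 3.5 × 10⁶`", for which
Zhang appeals to Dusart's explicit bounds for `π(x)`; Ram Murty, p. 9).  Here instead from the tree's certified
prime counts: `π(3.5·10⁶) ≤ π(5·10⁶ − 1) = 348 513` and `π(7·10⁷) = 4 118 064`, and
`348 513 + 3 500 000 = 3 848 513 < 4 118 064`.  Computational (inherits `Lean.ofReduceBool` from
`SchoenfeldSieve.checkSeg_00–13`). [cite: ZhangAnnals2014, Theorem 1, deduction of the second clause][cite: RamMurty2013Zhang, p. 9] -/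
theorem primeCounting_zhang_holds : primeCounting_zhang := by
  unfold primeCounting_zhang
  rw [primeCounting_seventyMillion]
  have h := primeCounting_threePointFiveMillion_le
  omega

/-- The inequality as printed, `π(7·10⁷) − π(3.5·10⁶) > 3.5·10⁶` (truncated subtraction is harmless here:
`π(3.5·10⁶) ≤ π(7·10⁷)`). [cite: ZhangAnnals2014, Theorem 1, deduction of the second clause] -/
theorem primeCounting_zhang_sub :
    3500000 < Nat.primeCounting (7 * 10 ^ 7) - Nat.primeCounting 3500000 := by
  have h := primeCounting_zhang_holds
  unfold primeCounting_zhang at h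
  omega

/-- **Zhang's printed deduction on proved inputs**: the consequence clause parity.S13
`frequently_nth_prime_succ_lt_add_zhang` (`p_{n+1} < p_n + 7·10⁷` infinitely often) by Zhang's own
one-sentence argument `frequently_nth_prime_succ_lt_add_zhang_of_weakDHL` (`k₀` primes in `(3.5·10⁶, 7·10⁷]`
form an admissible tuple of diameter `< 7·10⁷`), now fed with the PROVED main clause `weakDHL_two_zhang_holds`
and the PROVED count `primeCounting_zhang_holds` — a second proof of `frequently_nth_prime_succ_lt_add_zhang_holds`
that passes through `DHL[3 500 000, 2]` exactly as printed (the main clause itself still comes by the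
Maynard–Tao route). [cite: ZhangAnnals2014, Theorem 1 (second clause from the first)] -/
theorem frequently_nth_prime_succ_lt_add_zhang_of_primeCounts : frequently_nth_prime_succ_lt_add_zhang :=
  frequently_nth_prime_succ_lt_add_zhang_of_weakDHL weakDHL_two_zhang_holds primeCounting_zhang_holds

end Literature.NumberTheory.Sieve
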